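import Mathlib
import Literature.Barriers.MatrixMultiplication.NormalizerBarrier
import Summits.MatrixMultiplication.MatrixMultiplication.Theorems.LieRankDesigns.Negative.Basics
import Summits.MatrixMultiplication.MatrixMultiplication.Theorems.SubgroupIdentityDesigns.Negative.ScalarLaw
import Summits.MatrixMultiplication.MatrixMultiplication.Theorems.SubgroupIdentityDesigns.Negative.ProjectiveReduction
import Summits.MatrixMultiplication.MatrixMultiplication.Theorems.SubgroupIdentityDesigns.Negative.NearFloorVolume

/-!
# The PROJECTIVE-IMAGE CEILING for the `(m,k) = (2,1)` cell of `SubgroupIdentityDesigns`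

Route `LevelGradedCohnUmans`, crux `SubgroupIdentityDesigns` (stmt-MatrixMultiplication-14079),
negative side, cell `(m,k) = (2,1)`, all primes `p`.  This file assembles three landed engines —
the SCALAR LAW (`ScalarLaw`: the scalar parts `Sᵢ = Hᵢ ∩ Z` of a subgroup-TPP triple have
`|S₁||S₂||S₃| ≤ p - 1`), the index identity `|H| ≤ |S_H| · |HZ/Z|` and the NEAR-FLOOR CEILING
(`NearFloorVolume`: a triple of volume `≤ (p-1)(p+1)³` serves no `ε ≤ 0.98` when `p ≥ 61`) — into
the statement the order-profile sieve of the cell actually uses: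

* `card_map_mk_le_div` — if `H ≤ K` for a subgroup `K ⊇ Z` (`Z` = the scalars), the image of `H` in
  `PGL_m(𝔽_p) = GL_m(𝔽_p)/Z` has order `≤ |K| / (p-1)`; e.g. a subgroup of a torus of order
  `p² - 1` (resp. `(p-1)²`) has projective image of order `≤ p+1` (resp. `≤ p-1`)
  (`card_map_mk_le_of_le_torus`);
* `no_levelOne_witness_of_scalar_index_le` — **if every member of a subgroup-TPP triple in
  `GL₂(𝔽_p)`, `p ≥ 61`, satisfies `|Hᵢ| ≤ |Sᵢ| · (p+1)`, the level-one crux inequality fails for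
  every `-2 < ε ≤ 49/50`;**
* `no_levelOne_witness_of_image_le` — the same with the hypothesis stated on the PROJECTIVE IMAGES:
  `|Hᵢ Z / Z| ≤ p + 1` for `i = 1, 2, 3`;
* `no_levelOne_witness_of_le_tori` — in particular three members each contained in a
  scalar-containing subgroup of order `≤ p² - 1` (split or non-split torus, or anything smaller)
  never witness the cell for `ε ≤ 0.98`, `p ≥ 61`.

What is NOT proved here (paper / data, ORACLE-g16 §G16-2): that every `p`-free member WITH A FREE
VECTOR has projective image of order `≤ p + 1` once `p ≥ 61` (Dickson's list: torus normalisers,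
where the full dihedral image kills the free vector, and `A₄/S₄/A₅` of order `≤ 60`).  Granted that,
the theorems below say the `(2,1)` cell has no witness at any prime for any `ε ≤ 0.98`.
VALUE = THEOREM (all `p`), NOT summit progress; the crux item is untouched and remains open.
Report: `run/shared/lean/b2b/levelgraded-cu/ORACLE-g16.md` §G16-6.
-/

set_option linter.dupNamespace false

noncomputable section

open scoped Classical
open Summit.MatrixMultiplication.MatrixMultiplication.Theorems.LieRankDesigns.Negative (GLm Mat budget)
open Literature.Barriers.MatrixMultiplication (SubgroupTPP)

namespace Summit.MatrixMultiplication.MatrixMultiplication.Theorems.SubgroupIdentityDesigns.Negative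

section ImageCeiling

variable {p : ℕ} [hp : Fact p.Prime] {m : ℕ}

/-- The scalar subgroup `Z = range (scalarHom p m)` has order `p - 1` (`m ≥ 1`). -/
theorem card_range_scalarHom [NeZero m] : Nat.card ((scalarHom p m).range) = p - 1 := by
  have h : Nat.card (ZMod p)ˣ = p - 1 := by
    rw [Nat.card_eq_fintype_card, ZMod.card_units]
  rw [← h]
  exact (Nat.card_congr (MonoidHom.ofInjective scalarHom_injective).toEquiv).symm

/-- **Index bound through a scalar-containing overgroup.**  If `H ≤ K` and `Z ≤ K`, the projective
image `H Z / Z` of `H` has order at most `|K| / (p - 1)`. -/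
theorem card_map_mk_le_div [NeZero m] {H K : Subgroup (GLm p m)} (hHK : H ≤ K)
    (hZK : (scalarHom p m).range ≤ K) :
    Nat.card (H.map (QuotientGroup.mk' (scalarHom p m).range)) ≤ Nat.card K / (p - 1) := by
  classical
  set Z := (scalarHom p m).range with hZ
  set π := QuotientGroup.mk' Z with hπ
  have hle : Nat.card (H.map π) ≤ Nat.card (K.map π) :=
    Subgroup.card_le_of_le (Subgroup.map_mono hHK)
  -- |Z| * |K.map π| = |K| : the kernel of π restricted to K is Z (as a subgroup of K)
  have e1 : ((π.comp K.subtype).ker).index = Nat.card (K.map π) := by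
    rw [Subgroup.index_ker, MonoidHom.range_comp, Subgroup.range_subtype]
  have eker : (π.comp K.subtype).ker = Z.subgroupOf K := by
    rw [← MonoidHom.comap_ker, hπ, QuotientGroup.ker_mk']
    rfl
  have e2 : Nat.card (Z.subgroupOf K) = Nat.card Z :=
    Nat.card_congr (Subgroup.subgroupOfEquivOfLe hZK).toEquiv
  have h3 : Nat.card (Z.subgroupOf K) * (Z.subgroupOf K).index = Nat.card K :=
    Subgroup.card_mul_index _
  rw [e2, ← eker, e1] at h3
  have hZc : Nat.card Z = p - 1 := card_range_scalarHom
  have hp1 : 0 < p - 1 := Nat.sub_pos_of_lt hp.out.one_lt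
  rw [hZc] at h3
  calc Nat.card (H.map π) ≤ Nat.card (K.map π) := hle
    _ = Nat.card K / (p - 1) := by
        rw [← h3, Nat.mul_div_cancel_left _ hp1]

/-- Torus form: a member inside a scalar-containing subgroup of order `≤ (p-1)·N` has projective
image of order `≤ N` (e.g. `N = p+1` for the non-split torus `C_{p²-1}`, `N = p-1` for the split
torus). -/
theorem card_map_mk_le_of_le_torus [NeZero m] {H K : Subgroup (GLm p m)} (hHK : H ≤ K)
    (hZK : (scalarHom p m).range ≤ K) {N : ℕ} (hK : Nat.card K ≤ (p - 1) * N) :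
    Nat.card (H.map (QuotientGroup.mk' (scalarHom p m).range)) ≤ N := by
  have hp1 : 0 < p - 1 := Nat.sub_pos_of_lt hp.out.one_lt
  calc Nat.card (H.map (QuotientGroup.mk' (scalarHom p m).range))
      ≤ Nat.card K / (p - 1) := card_map_mk_le_div hHK hZK
    _ ≤ (p - 1) * N / (p - 1) := Nat.div_le_div_right hK
    _ = N := by rw [Nat.mul_div_cancel_left _ hp1]

/-- `|H| ≤ |S_H| · |H Z / Z|` — the instance of `card_le_scalar_mul_card_map` for the quotient
map by the scalars (its kernel IS the scalars). -/
theorem card_le_scalar_mul_card_image [NeZero m] (H : Subgroup (GLm p m)) :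
    Nat.card H ≤ Nat.card (H.comap (scalarHom p m)) *
      Nat.card (H.map (QuotientGroup.mk' (scalarHom p m).range)) := by
  refine card_le_scalar_mul_card_map _ H ?_
  intro h _ h1
  rwa [← MonoidHom.mem_ker, QuotientGroup.ker_mk'] at h1

/-- **Scalar-index form of the ceiling (`m = 2`, level one, `p ≥ 61`).**  If every member of a
subgroup-TPP triple satisfies `|Hᵢ| ≤ |Sᵢ| · (p + 1)` (`Sᵢ` its scalar part), then
`|H₁||H₂||H₃| ≤ (p-1)(p+1)³` by the scalar law, and the level-one crux inequality fails for every
`-2 < ε ≤ 49/50` (`NearFloorVolume`). -/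
theorem no_levelOne_witness_of_scalar_index_le (hp61 : 61 ≤ p) {ε : ℝ} (hε : -2 < ε)
    (hε1 : ε ≤ 49 / 50) {H₁ H₂ H₃ : Subgroup (GLm p 2)} (htpp : SubgroupTPP H₁ H₂ H₃)
    (h₁ : Nat.card H₁ ≤ Nat.card (H₁.comap (scalarHom p 2)) * (p + 1))
    (h₂ : Nat.card H₂ ≤ Nat.card (H₂.comap (scalarHom p 2)) * (p + 1))
    (h₃ : Nat.card H₃ ≤ Nat.card (H₃.comap (scalarHom p 2)) * (p + 1)) :
    ¬ budget p 2 1 (2 + ε) <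
      ((Nat.card H₁ * Nat.card H₂ * Nat.card H₃ : ℕ) : ℝ) ^ ((2 + ε) / 3) := by
  refine no_levelOne_witness_familyI_sixtyone hp61 hε hε1 ?_
  have hV := volume_le_of_scalar_index htpp h₁ h₂ h₃
  calc Nat.card H₁ * Nat.card H₂ * Nat.card H₃ ≤ (p - 1) * ((p + 1) * (p + 1) * (p + 1)) := hV
    _ = (p - 1) * (p + 1) ^ 3 := by ring

/-- **Projective-image form of the ceiling.**  If the three members of a subgroup-TPP triple in
`GL₂(𝔽_p)`, `p ≥ 61`, have projective images `Hᵢ Z / Z ≤ PGL₂(𝔽_p)` of order `≤ p + 1`, the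
level-one crux inequality fails for every `-2 < ε ≤ 49/50`. -/
theorem no_levelOne_witness_of_image_le (hp61 : 61 ≤ p) {ε : ℝ} (hε : -2 < ε)
    (hε1 : ε ≤ 49 / 50) {H₁ H₂ H₃ : Subgroup (GLm p 2)} (htpp : SubgroupTPP H₁ H₂ H₃)
    (h₁ : Nat.card (H₁.map (QuotientGroup.mk' (scalarHom p 2).range)) ≤ p + 1)
    (h₂ : Nat.card (H₂.map (QuotientGroup.mk' (scalarHom p 2).range)) ≤ p + 1)
    (h₃ : Nat.card (H₃.map (QuotientGroup.mk' (scalarHom p 2).range)) ≤ p + 1) :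
    ¬ budget p 2 1 (2 + ε) <
      ((Nat.card H₁ * Nat.card H₂ * Nat.card H₃ : ℕ) : ℝ) ^ ((2 + ε) / 3) :=
  no_levelOne_witness_of_scalar_index_le hp61 hε hε1 htpp
    ((card_le_scalar_mul_card_image H₁).trans (Nat.mul_le_mul_left _ h₁))
    ((card_le_scalar_mul_card_image H₂).trans (Nat.mul_le_mul_left _ h₂))
    ((card_le_scalar_mul_card_image H₃).trans (Nat.mul_le_mul_left _ h₃))

/-- **Torus members never witness the cell below `ε = 0.98`.**  If each member of a subgroup-TPP
triple in `GL₂(𝔽_p)`, `p ≥ 61`, lies in some scalar-containing subgroup `Kᵢ` of order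
`≤ (p-1)(p+1) = p² - 1` (a split or non-split torus, or any smaller scalar-containing group), the
level-one crux inequality fails for every `-2 < ε ≤ 49/50`. -/
theorem no_levelOne_witness_of_le_tori (hp61 : 61 ≤ p) {ε : ℝ} (hε : -2 < ε)
    (hε1 : ε ≤ 49 / 50) {H₁ H₂ H₃ : Subgroup (GLm p 2)} (htpp : SubgroupTPP H₁ H₂ H₃)
    {K₁ K₂ K₃ : Subgroup (GLm p 2)} (hH₁ : H₁ ≤ K₁) (hH₂ : H₂ ≤ K₂) (hH₃ : H₃ ≤ K₃)
    (hZ₁ : (scalarHom p 2).range ≤ K₁) (hZ₂ : (scalarHom p 2).range ≤ K₂)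
    (hZ₃ : (scalarHom p 2).range ≤ K₃)
    (hK₁ : Nat.card K₁ ≤ (p - 1) * (p + 1)) (hK₂ : Nat.card K₂ ≤ (p - 1) * (p + 1))
    (hK₃ : Nat.card K₃ ≤ (p - 1) * (p + 1)) :
    ¬ budget p 2 1 (2 + ε) <
      ((Nat.card H₁ * Nat.card H₂ * Nat.card H₃ : ℕ) : ℝ) ^ ((2 + ε) / 3) :=
  no_levelOne_witness_of_image_le hp61 hε hε1 htpp
    (card_map_mk_le_of_le_torus hH₁ hZ₁ hK₁) (card_map_mk_le_of_le_torus hH₂ hZ₂ hK₂)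
    (card_map_mk_le_of_le_torus hH₃ hZ₃ hK₃)

end ImageCeiling

end Summit.MatrixMultiplication.MatrixMultiplication.Theorems.SubgroupIdentityDesigns.Negative

end
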